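import Summits.ValiantsHypothesis.ValiantsHypothesis.Theorems.KPlusLogSqLawWeakLiftingTowerGraftTwoSidedThreeLettersLaw
import Summits.ValiantsHypothesis.ValiantsHypothesis.Theorems.KPlusLogSqLawWeakLiftingTowerGraftTwoSidedClusteredLowers

/-!
# The MIRROR four-letter `2m` law on `(d₀, d₀+g, d₀+2g, d₀+4g)` (pub-symmetroid LINE (B) `tower_graft`, helper lane)

Census-currency companion of part H (`TwoSidedThree.card_posType_le_rank_four_letters_lower`: for `P₁ + τP₂ + τ²J + τ⁴C` with
`P₁, P₂, C ⪰ 0`, `J` any symmetric, the EXITING-type kernel scales number at most `rank C`).  With `P₁ ≻ 0`, `C ≻ 0` and simple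
crossings the global index formula (`ν(P₁) = ν(C) = 0 ⇒ N⁺ = N⁻`) turns it into
`card_posRoots_le_two_mul_four_letters_lower`: `F(X) = X^{d₀}P₁ + X^{d₀+g}P₂ + X^{d₀+2g}J + X^{d₀+4g}C` has at most `2m` positive
determinant zeros with multiplicity — the support family `(0,1,2,4)·g + d₀`, two PSD letters clustered BELOW the pivot (located: `4 = 2m`
at `m = 2`, `6 = 2m` at `m = 3`).  Dictionary: `t·P_u′(t) = g·t^{d₀}·(2τ⁴⟨u,Cu⟩ − 2⟨u,P₁u⟩ − τ⟨u,P₂u⟩)`, `τ = t^g`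
(`rayleigh_deriv_eq4_lower`).

Honest scope: clustered support only; nothing on S4/S4b/S4d/S4f/S5, (TB), 19561 proper, 18050, VP ≠ VNP.
-/

set_option linter.dupNamespace false
set_option autoImplicit false

namespace Summit.ValiantsHypothesis.ValiantsHypothesis.Theorems.KPlusLogSqLaw.TowerGraft

open Matrix
open scoped BigOperators

namespace TwoSidedThree

section FourLettersLower

open Polynomial
open Summit.ValiantsHypothesis.ValiantsHypothesis.Theorems.LacunarySymmetroidMatrixDescartes

variable {m : ℕ}

/-- the mirror four-letter pencil evaluated at `t` is `t^{d₀}·(P₁ + τP₂ + τ²J + τ⁴C)`, `τ = t^g`. [folklore] -/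
theorem pencil4_eval_lower (P₁ P₂ J C : Matrix (Fin m) (Fin m) ℝ) (d₀ g : ℕ) (t : ℝ) :
    (∑ k : Fin 4, t ^ (![d₀, d₀ + g, d₀ + 2 * g, d₀ + 4 * g] k) • (![P₁, P₂, J, C] k))
      = t ^ d₀ • (P₁ + (t ^ g) • P₂ + (t ^ g) ^ 2 • J + (t ^ g) ^ 4 • C) := by
  rw [Fin.sum_univ_four]
  simp only [Matrix.cons_val_zero, Matrix.cons_val_one, Matrix.cons_val]
  rw [show (t ^ g) ^ 2 = t ^ (2 * g) by rw [Nat.mul_comm 2 g, pow_mul],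
    show (t ^ g) ^ 4 = t ^ (4 * g) by rw [Nat.mul_comm 4 g, pow_mul],
    smul_add, smul_add, smul_add, smul_smul, smul_smul, smul_smul, ← pow_add, ← pow_add, ← pow_add]

/-- kernel vectors of the evaluated mirror pencil are kernel vectors of the reduced pencil. [folklore] -/
theorem reduced_kernel4_lower (P₁ P₂ J C : Matrix (Fin m) (Fin m) ℝ) (d₀ g : ℕ) {t : ℝ} (ht : 0 < t) (u : Fin m → ℝ)
    (hu : (∑ k : Fin 4, t ^ (![d₀, d₀ + g, d₀ + 2 * g, d₀ + 4 * g] k) • (![P₁, P₂, J, C] k)) *ᵥ u = 0) :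
    (P₁ + (t ^ g) • P₂ + (t ^ g) ^ 2 • J + (t ^ g) ^ 4 • C) *ᵥ u = 0 := by
  rw [pencil4_eval_lower, Matrix.smul_mulVec] at hu
  exact (smul_eq_zero.mp hu).resolve_left (pow_ne_zero _ (ne_of_gt ht))

/-- **type dictionary, mirror word**: at a kernel vector `u` of the pencil at `t > 0`, `τ = t^g`,
`t·P_u′(t) = g·t^{d₀}·(2τ⁴⟨u,Cu⟩ − 2⟨u,P₁u⟩ − τ⟨u,P₂u⟩)`. [folklore] -/
theorem rayleigh_deriv_eq4_lower (P₁ P₂ J C : Matrix (Fin m) (Fin m) ℝ) (d₀ g : ℕ) {t : ℝ} (ht : 0 < t) (u : Fin m → ℝ)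
    (hu : (∑ k : Fin 4, t ^ (![d₀, d₀ + g, d₀ + 2 * g, d₀ + 4 * g] k) • (![P₁, P₂, J, C] k)) *ᵥ u = 0) :
    t * (derivative (∑ k : Fin 4, Polynomial.C (u ⬝ᵥ ((![P₁, P₂, J, C] k) *ᵥ u)) *
        (X : ℝ[X]) ^ (![d₀, d₀ + g, d₀ + 2 * g, d₀ + 4 * g] k))).eval t
      = (g : ℝ) * t ^ d₀ * (2 * (t ^ g) ^ 4 * (u ⬝ᵥ (C *ᵥ u)) - 2 * (u ⬝ᵥ (P₁ *ᵥ u)) - (t ^ g) * (u ⬝ᵥ (P₂ *ᵥ u))) := by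
  have hred := reduced_kernel4_lower P₁ P₂ J C d₀ g ht u hu
  have hray : u ⬝ᵥ (P₁ *ᵥ u) + (t ^ g) * (u ⬝ᵥ (P₂ *ᵥ u)) + (t ^ g) ^ 2 * (u ⬝ᵥ (J *ᵥ u))
      + (t ^ g) ^ 4 * (u ⬝ᵥ (C *ᵥ u)) = 0 := by
    have h := congrArg (fun w => u ⬝ᵥ w) hred
    simp only [dotProduct_zero, Matrix.add_mulVec, Matrix.smul_mulVec, dotProduct_add, dotProduct_smul,
      smul_eq_mul] at h
    linarith
  rw [← Multiplicity.form_derivative_eq_eval]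
  rw [Fin.sum_univ_four]
  simp only [Matrix.cons_val_zero, Matrix.cons_val_one, Matrix.cons_val, Matrix.add_mulVec, Matrix.smul_mulVec,
    dotProduct_add, dotProduct_smul, smul_eq_mul]
  have h0 := SecularRolle.mul_natCast_mul_pow_pred t d₀
  have h1 := SecularRolle.mul_natCast_mul_pow_pred t (d₀ + g)
  have h2 := SecularRolle.mul_natCast_mul_pow_pred t (d₀ + 2 * g)
  have h3 := SecularRolle.mul_natCast_mul_pow_pred t (d₀ + 4 * g)
  rw [show t * (↑d₀ * t ^ (d₀ - 1) * (u ⬝ᵥ (P₁ *ᵥ u)) + ↑(d₀ + g) * t ^ (d₀ + g - 1) * (u ⬝ᵥ (P₂ *ᵥ u))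
        + ↑(d₀ + 2 * g) * t ^ (d₀ + 2 * g - 1) * (u ⬝ᵥ (J *ᵥ u)) + ↑(d₀ + 4 * g) * t ^ (d₀ + 4 * g - 1) * (u ⬝ᵥ (C *ᵥ u)))
      = (t * (↑d₀ * t ^ (d₀ - 1))) * (u ⬝ᵥ (P₁ *ᵥ u)) + (t * (↑(d₀ + g) * t ^ (d₀ + g - 1))) * (u ⬝ᵥ (P₂ *ᵥ u))
        + (t * (↑(d₀ + 2 * g) * t ^ (d₀ + 2 * g - 1))) * (u ⬝ᵥ (J *ᵥ u))
        + (t * (↑(d₀ + 4 * g) * t ^ (d₀ + 4 * g - 1))) * (u ⬝ᵥ (C *ᵥ u)) by ring, h0, h1, h2, h3]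
  push_cast
  have e1 : t ^ (d₀ + g) = t ^ d₀ * t ^ g := by rw [pow_add]
  have e2 : t ^ (d₀ + 2 * g) = t ^ d₀ * (t ^ g) ^ 2 := by rw [pow_add, Nat.mul_comm 2 g, pow_mul]
  have e4 : t ^ (d₀ + 4 * g) = t ^ d₀ * (t ^ g) ^ 4 := by rw [pow_add, Nat.mul_comm 4 g, pow_mul]
  have hJ : (t ^ g) ^ 2 * (u ⬝ᵥ (J *ᵥ u)) = -(u ⬝ᵥ (P₁ *ᵥ u)) - (t ^ g) * (u ⬝ᵥ (P₂ *ᵥ u))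
      - (t ^ g) ^ 4 * (u ⬝ᵥ (C *ᵥ u)) := by linarith
  rw [e1, e2, e4]
  have h4 : (↑(d₀) + 2 * ↑g : ℝ) * (t ^ d₀ * (t ^ g) ^ 2) * (u ⬝ᵥ (J *ᵥ u))
      = (↑d₀ + 2 * ↑g) * t ^ d₀ * ((t ^ g) ^ 2 * (u ⬝ᵥ (J *ᵥ u))) := by ring
  rw [h4, hJ]
  ring

/-- **THE MIRROR FOUR-LETTER `2m` LAW** (`(d₀, d₀+g, d₀+2g, d₀+4g)`, e.g. `(0,1,2,4)`).  `P₁ ≻ 0`, `C ≻ 0`, `P₂ ⪰ 0`, `J` ANY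
symmetric, `g ≥ 1`, `F(X) = X^{d₀}P₁ + X^{d₀+g}P₂ + X^{d₀+2g}J + X^{d₀+4g}C`; if every positive root of `det F` is a SIMPLE CROSSING of
definite type, then `det F` has at most `2m` positive roots counted with multiplicity: EXITING-type roots `≤ rank C = m`
(`card_posType_le_rank_four_letters_lower`) and `N⁺ = N⁻` (`Inertia.global_index_formula`, `ν(P₁) = ν(C) = 0`). [folklore] -/
theorem card_posRoots_le_two_mul_four_letters_lower (P₁ P₂ J C : Matrix (Fin m) (Fin m) ℝ) (hP₁ : P₁.PosDef) (hP₂ : P₂.PosSemidef)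
    (hJ : J.IsSymm) (hC : C.PosDef) (d₀ g : ℕ) (hg : 0 < g)
    (hcorank : ∀ t : ℝ, 0 < t →
      (∑ k : Fin 4, t ^ (![d₀, d₀ + g, d₀ + 2 * g, d₀ + 4 * g] k) • (![P₁, P₂, J, C] k)).det = 0 →
      (∑ k : Fin 4, t ^ (![d₀, d₀ + g, d₀ + 2 * g, d₀ + 4 * g] k) • (![P₁, P₂, J, C] k)).rank + 1 = m)
    (htype : ∀ t : ℝ, 0 < t →
      (∑ k : Fin 4, t ^ (![d₀, d₀ + g, d₀ + 2 * g, d₀ + 4 * g] k) • (![P₁, P₂, J, C] k)).det = 0 →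
      (∀ u : Fin m → ℝ, (∑ k : Fin 4, t ^ (![d₀, d₀ + g, d₀ + 2 * g, d₀ + 4 * g] k) • (![P₁, P₂, J, C] k)) *ᵥ u = 0 →
        u ≠ 0 → (derivative (∑ k : Fin 4, Polynomial.C (u ⬝ᵥ ((![P₁, P₂, J, C] k) *ᵥ u)) *
          (X : ℝ[X]) ^ (![d₀, d₀ + g, d₀ + 2 * g, d₀ + 4 * g] k))).eval t < 0) ∨
      (∀ u : Fin m → ℝ, (∑ k : Fin 4, t ^ (![d₀, d₀ + g, d₀ + 2 * g, d₀ + 4 * g] k) • (![P₁, P₂, J, C] k)) *ᵥ u = 0 →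
        u ≠ 0 → 0 < (derivative (∑ k : Fin 4, Polynomial.C (u ⬝ᵥ ((![P₁, P₂, J, C] k) *ᵥ u)) *
          (X : ℝ[X]) ^ (![d₀, d₀ + g, d₀ + 2 * g, d₀ + 4 * g] k))).eval t)) :
    Multiset.card ((Matrix.det (∑ k : Fin 4, ((X : ℝ[X]) ^ (![d₀, d₀ + g, d₀ + 2 * g, d₀ + 4 * g] k)) •
      (![P₁, P₂, J, C] k).map Polynomial.C)).roots.filter (fun t => 0 < t)) ≤ 2 * m := by
  classical
  set dv : Fin 4 → ℕ := ![d₀, d₀ + g, d₀ + 2 * g, d₀ + 4 * g] with hdv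
  set Sv : Fin 4 → Matrix (Fin m) (Fin m) ℝ := ![P₁, P₂, J, C] with hSv
  have hP₁s : P₁.IsSymm := by
    have h1 := hP₁.1; unfold Matrix.IsHermitian at h1
    rwa [Matrix.conjTranspose_eq_transpose_of_trivial] at h1
  have hP₂s : P₂.IsSymm := by
    have h1 := hP₂.1; unfold Matrix.IsHermitian at h1
    rwa [Matrix.conjTranspose_eq_transpose_of_trivial] at h1
  have hCs : C.IsSymm := by
    have h1 := hC.1; unfold Matrix.IsHermitian at h1
    rwa [Matrix.conjTranspose_eq_transpose_of_trivial] at h1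
  have hS : ∀ k, (Sv k).IsSymm := by
    intro k; fin_cases k
    · exact hP₁s
    · exact hP₂s
    · exact hJ
    · exact hCs
  have hmin : ∀ l : Fin 4, l ≠ 0 → dv 0 < dv l := by
    intro l hl; fin_cases l
    · exact absurd rfl hl
    · show d₀ < d₀ + g; omega
    · show d₀ < d₀ + 2 * g; omega
    · show d₀ < d₀ + 4 * g; omega
  have hmax : ∀ l : Fin 4, l ≠ 3 → dv l < dv 3 := by
    intro l hl; fin_cases l
    · show d₀ < d₀ + 4 * g; omega
    · show d₀ + g < d₀ + 4 * g; omega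
    · show d₀ + 2 * g < d₀ + 4 * g; omega
    · exact absurd rfl hl
  have h0 : (Sv 0).det ≠ 0 := by show P₁.det ≠ 0; exact hP₁.det_pos.ne'
  have h3 : (Sv 3).det ≠ 0 := by show C.det ≠ 0; exact hC.det_pos.ne'
  let negType : ℝ → Prop := fun t => ∀ u : Fin m → ℝ, (∑ k, t ^ dv k • Sv k) *ᵥ u = 0 → u ≠ 0 →
    (derivative (∑ k, Polynomial.C (u ⬝ᵥ (Sv k *ᵥ u)) * (X : ℝ[X]) ^ dv k)).eval t < 0
  obtain ⟨hidx, -, hsum⟩ := Inertia.global_index_formula dv Sv hS 0 3 hmin hmax h0 h3 htype negType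
    (fun t _ _ => Iff.rfl)
  have hν0 : Fintype.card {j // (Inertia.isHermitian_of_isSymm (hS 0)).eigenvalues j < 0} = 0 := by
    rw [Fintype.card_eq_zero_iff]
    refine ⟨fun ⟨j, hj⟩ => ?_⟩
    have hp : 0 < (Inertia.isHermitian_of_isSymm (hS 0)).eigenvalues j := hP₁.eigenvalues_pos j
    linarith
  have hν3 : Fintype.card {j // (Inertia.isHermitian_of_isSymm (hS 3)).eigenvalues j < 0} = 0 := by
    rw [Fintype.card_eq_zero_iff]
    refine ⟨fun ⟨j, hj⟩ => ?_⟩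
    have hp : 0 < (Inertia.isHermitian_of_isSymm (hS 3)).eigenvalues j := hC.eigenvalues_pos j
    linarith
  rw [hν0, hν3, zero_add, zero_add] at hidx
  set P := Matrix.det (∑ k, ((X : ℝ[X]) ^ dv k) • (Sv k).map Polynomial.C) with hP
  have hdef : ∀ t : ℝ, 0 < t → (∑ k, t ^ dv k • Sv k).det = 0 → ∀ v : Fin m → ℝ, (∑ k, t ^ dv k • Sv k) *ᵥ v = 0 →
      v ≠ 0 → (derivative (∑ k, Polynomial.C (v ⬝ᵥ (Sv k *ᵥ v)) * (X : ℝ[X]) ^ dv k)).eval t ≠ 0 := by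
    intro t ht hdet v hv hv0
    rcases htype t ht hdet with h | h
    · exact ne_of_lt (h v hv hv0)
    · exact ne_of_gt (h v hv hv0)
  -- the POSITIVE-type (exiting) positive roots: a multiset without repetition
  set q : ℝ → Prop := fun t => 0 < t ∧ ¬ negType t with hq
  have hnodup : (P.roots.filter q).Nodup := by
    rw [Multiset.nodup_iff_count_le_one]
    intro a
    by_cases hqa : q a
    · rw [Multiset.count_filter_of_pos hqa, count_roots]
      by_cases hr : (∑ k, a ^ dv k • Sv k).det = 0
      · have h1 := Multiplicity.rootMultiplicity_det_pencil_eq_one dv Sv hS a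
          (by rw [Fintype.card_fin]; exact hcorank a hqa.1 hr) (hdef a hqa.1 hr)
        rw [← hP] at h1
        omega
      · have hnr : ¬ P.IsRoot a := by
          intro hroot
          apply hr
          have h1 : P.eval a = 0 := hroot
          rwa [hP, DefiniteMoments.eval_det_pencil] at h1
        rw [Polynomial.rootMultiplicity_eq_zero hnr]
        exact zero_le_one
    · rw [Multiset.count_filter_of_neg hqa]
      exact zero_le_one
  set T := (P.roots.filter q).toFinset with hTdef
  have hTcard : T.card = Multiset.card (P.roots.filter q) := Multiset.toFinset_card_of_nodup hnodup
  have hTpos : ∀ t ∈ T, 0 < t := fun t ht => (Multiset.mem_filter.mp (Multiset.mem_toFinset.mp ht)).2.1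
  have hTroot : ∀ t ∈ T, ∃ u : Fin m → ℝ, (∑ k : Fin 4, t ^ (dv k) • (Sv k)) *ᵥ u = 0 ∧ u ≠ 0 ∧
      0 < (derivative (∑ k : Fin 4, Polynomial.C (u ⬝ᵥ ((Sv k) *ᵥ u)) * (X : ℝ[X]) ^ (dv k))).eval t := by
    intro t ht
    obtain ⟨hmem, htq⟩ := Multiset.mem_filter.mp (Multiset.mem_toFinset.mp ht)
    obtain ⟨hP0, hroot⟩ := (Polynomial.mem_roots').mp hmem
    have hdet : (∑ k, t ^ dv k • Sv k).det = 0 := by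
      have h1 : P.eval t = 0 := hroot
      rwa [hP, DefiniteMoments.eval_det_pencil] at h1
    obtain ⟨u, hu0, hu⟩ := Matrix.exists_mulVec_eq_zero_iff.mpr hdet
    rcases htype t htq.1 hdet with hneg | hposT
    · exact absurd hneg htq.2
    · exact ⟨u, hu, hu0, hposT u hu hu0⟩
  choose! u hu using hTroot
  have hTle : T.card ≤ C.rank := by
    have h := card_posType_le_rank_four_letters_lower (I := T) P₁ P₂ J C (fun t => ((t : ℝ)) ^ g) (fun t => u t)
      hP₁.posSemidef hP₂ hJ hC.posSemidef (fun t => pow_pos (hTpos t t.2) g)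
      (fun t t' htt' => Subtype.coe_injective
        ((pow_left_inj₀ (hTpos t t.2).le (hTpos t' t'.2).le (Nat.pos_iff_ne_zero.mp hg)).mp htt'))
      (fun t => reduced_kernel4_lower P₁ P₂ J C d₀ g (hTpos t t.2) _ (hu t t.2).1) ?_
    · simpa using h
    · intro t
      have ht := hTpos t t.2
      have hposT := (hu t t.2).2.2
      have heq := rayleigh_deriv_eq4_lower P₁ P₂ J C d₀ g ht _ (hu t t.2).1
      have h1 : 0 < t * (derivative (∑ k : Fin 4, Polynomial.C (u t ⬝ᵥ ((![P₁, P₂, J, C] k) *ᵥ u t)) *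
          (X : ℝ[X]) ^ (![d₀, d₀ + g, d₀ + 2 * g, d₀ + 4 * g] k))).eval (t : ℝ) := mul_pos ht hposT
      rw [heq] at h1
      have h2 : 0 < (g : ℝ) * (t : ℝ) ^ d₀ := mul_pos (Nat.cast_pos.mpr hg) (pow_pos ht _)
      by_contra hcon
      push Not at hcon
      have h3 : 2 * ((t : ℝ) ^ g) ^ 4 * (u t ⬝ᵥ (C *ᵥ u t)) - 2 * (u t ⬝ᵥ (P₁ *ᵥ u t))
          - (t : ℝ) ^ g * (u t ⬝ᵥ (P₂ *ᵥ u t)) ≤ 0 := by linarith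
      have := mul_nonpos_of_nonneg_of_nonpos h2.le h3
      linarith
  have hCm : C.rank ≤ m := (Matrix.rank_le_width C).trans le_rfl
  rw [← hsum]
  have hN : Multiset.card (P.roots.filter q) ≤ m := by rw [← hTcard]; exact hTle.trans hCm
  have hidx' : Multiset.card (P.roots.filter fun t => 0 < t ∧ negType t) = Multiset.card (P.roots.filter q) := hidx.symm
  rw [hidx']
  omega


end FourLettersLower

end TwoSidedThree

end Summit.ValiantsHypothesis.ValiantsHypothesis.Theorems.KPlusLogSqLaw.TowerGraft
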